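/-
Copyright (c) 2026. All rights reserved.
Released under Apache 2.0 license as described in the file LICENSE.
Authors: abc-iut cell, seat abc-iut-w6-d025 (gen 3; block C / W6, row «COR36-JOINT-TELE»), over seat
abc-iut-L4-t10's `FrobeniusPictureMLFLogTeleFamilyGlue.lean` (row «COR45-FULL-GLUECROSS») and MEMO
`HOME/staging/L4/abc-iut-L4-t10/g4/MEMO-Cor45-joint-witness.md` (route (β)).
-/
import Literature.AnabelianGeometry.AbsoluteAnabelian.AbsTopIII.FrobeniusPictureMLFTelecoreAgreement
import Literature.AnabelianGeometry.AbsoluteAnabelian.AbsTopIII.FrobeniusPictureMLFLogTeleFamilyGlue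

/-!
# [AbsTopIII] Cor. 3.6 (ii) ∧ (iii) ∧ (v): ONE telecore `𝔗_An` — the joint witness over the abstract data

S. Mochizuki, *Topics in Absolute Anabelian Geometry III*, Cor. 3.6 (ii), (iii) second clause, (v) fourth
sentence, pp. 79–81 of the kurims manuscript (`paper:url-5493eb38cbb7`; bib key `MochizukiAbsTopIII2015`).
Print: (ii) constructs ONE telecore `𝔗_An` with contact structure `ℋ_An`; (iii) "[the family of `𝔖_log`]
is compatible with the families of homotopies that constitute the core and telecore structures of (i),
(ii)"; (v) "these self-equivalences also extend … to the telecore of (ii) … compatible with … this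
telecore structure … and `ℋ_An`" — ONE witness `(𝔗_An, ℋ_An)` shared by the three items (seat
abc-iut-L4-t10's finding F-L4t10g4-1: the cell's typed clauses `TelecoreStmt`, `LogObsCompatTelecoreStmt`,
`ShiftTelecoreCompatStmt` were discharged with two different telecores).

PROOF-ONLY assembly (no new notion): with `anTelecoreE_Jfam_eq` / `anContact_isContactAnE` /
`shiftTelecoreCompat_overE` (this seat, `FrobeniusPictureMLFTelecoreAgreement.lean`) and the telecore half
of (iii) over the pulled-back glue family (seat abc-iut-L4-t10, `logObsCompatTelecoreStmt_of_glueCross`;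
this seat's `logTeleFamily`), the telecore `anTelecoreE τ` OVER `ℰ` witnesses all three clauses AT ONCE:

* `exists_logTeleFamily_of_iotaOverGalois` — the (iii) telecore clause with EXPLICIT telecore
  `T = anTelecoreE τ` (the landed closers state `∃ T`): one family on `𝒟_An` containing `𝒥(anTelecoreE τ)`
  and the `𝔖_log` family `H₃`, for `id_⋎` fully faithful and `ι` over Galois;
* `joint_of_iotaOverGalois` — **∃ ONE `(H, T, ℋ_An)` with (ii) [printed shape, contact structure generated
  by the printed pairs with the printed homotopies] ∧ (iii)-telecore [one family ⊇ 𝒥_T, 𝔖_log] ∧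
  (v)-fourth sentence [`Φ_m` extend to `Ψ_m` on `𝒟_An`, identity at `Anab`, compatible with `𝒥_T` and
  `ℋ_An`]**, for every `Δ` with `id_⋎` fully faithful, coherent `τ`, `ι` over Galois (`IotaOverGaloisStmt`,
  F-0360 — PROVED at the MLF model) and every log-observable `H₃`; `joint_of_iotaOverGaloisStmt` takes
  `H₃` from `observableLogStmt`.  The typed joint statement (`Cor_3_6_joint` / `Cor_4_5_joint`) and its
  model / archimedean instances are seat abc-iut-L4-t10's (L4-lead m73); this file is the abstract body.

Pure category theory over the abstract data; nothing here takes a side on inter-universal Teichmüller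
theory or bears on [IUTchIII] Cor. 3.12; typed ≠ proved.
-/

namespace Literature.AnabelianGeometry.AbsoluteAnabelian

open _root_.CategoryTheory _root_.Quiver

universe u

namespace LogFrobeniusData

open DiagramOfCategories

variable (Δ : LogFrobeniusData.{u}) (τ : Δ.TelecoreData)

/-- **Cor. 3.6 (iii), second clause, telecore half, AT THE TELECORE `anTelecoreE τ`** (explicit `T`): for a
log-observable `H₃`, `id_⋎` fully faithful and `ι` over Galois, ONE family on `𝒟_An` — this seat's
`logTeleFamily` on abc-iut-L4-t10's pulled-back glue family — contains the telecore family
`𝒥(anTelecoreE τ)` and `H₃` (along `𝒟_{≤3} ↪ 𝒟_An`).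
[cite: MochizukiAbsTopIII2015, Corollary 3.6 (iii) p.80] -/
theorem exists_logTeleFamily_of_iotaOverGalois {H₃ : Δ.sub3.HomotopyFamily}
    (hH₃ : Δ.IsLogObservableFamily H₃) (hν : Δ.toNexus.FullyFaithful) (hι : Δ.IotaOverGaloisStmt) :
    ∃ K : (Δ.teleDiagram anJ (Δ.anTelMap τ)).HomotopyFamily,
      (Δ.anTelecoreE τ).Jfam.CompatibleAlong (𝟭q _) K ∧ H₃.CompatibleAlong (embLogTele anJ) K := by
  have hcross := Δ.glueCross_of_mapPath H₃ hH₃.1 fun _ _ r p q hh _ r₂ hd h' =>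
    imageCross_of_generators hH₃ (generatorCross_of_iotaOverGalois hH₃ hι) ((hH₃.1 p q).mp hh)
      r hh r₂ hd h'
  have hover : ∀ ⦃x y : FVtx.{u}⦄ ⦃u v : Path x y⦄
      (h : ((Δ.teleDiagram_comapAlong_jS τ).symm ▸ (Δ.glueFamily H₃ hH₃.1 hcross).comap jD).E u v),
      (Δ.teleOverE τ).IsOver (jS.mapPath u) (jS.mapPath v)
        (Δ.tailη τ ((Δ.teleDiagram_comapAlong_jS τ).symm ▸ (Δ.glueFamily H₃ hH₃.1 hcross).comap jD) h) :=
    fun _ _ _ _ h => glueTele_isOver τ hH₃ hcross h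
  refine ⟨Δ.logTeleFamily τ _ hν hover (fun _ _ _ _ _ h₁ h₂ => Δ.teleGlueη_trans_base τ _ h₁ h₂ _)
      (fun _ _ _ _ _ _ h r₁ r₂ => Δ.teleGlueη_whisker_base τ _ hover h r₁ r₂ _), ?_, ?_⟩
  · exact Δ.jfam_compatibleAlong_logTeleFamily τ _ hν hover _ _
  · exact Δ.compatibleAlong_embLogTele_logTeleFamily τ _ hν hover _ _ H₃
      (compatibleAlong_logToF_glueTele τ hH₃ hcross)

/-- **[AbsTopIII] Cor. 3.6 (ii) ∧ (iii)-telecore ∧ (v)-fourth-sentence with ONE telecore** (joint witness,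
F-L4t10g4-1): for every `Δ` with `id_⋎` fully faithful, every coherent first-row telecore datum `τ`, `ι`
over Galois, and every log-observable family `H₃`, there are ONE core `(𝒟_{≤5}, Anab, H)`, ONE telecore `T`
of the printed shape over it and ONE family `ℋ_An` on `𝒟_An` such that: `ℋ_An` is a contact structure for
`T` generated by the printed pairs with the printed homotopies (the body of (ii)); ONE family on `𝒟_An`
contains `𝒥_T` and `H₃` ((iii), second clause, telecore half); and the nexus self-equivalences `Φ_m`
extend to self-equivalences `Ψ_m` of `𝒟_An` — same on `𝒟_{≤4}`, identity at `Anab` — compatible with `𝒥_T`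
and with `ℋ_An` ((v), fourth sentence).  Witnesses: `anCoreFamilyE`, `anTelecoreE τ`, `anContact τ hν`,
`logTeleFamily`, `shiftEquiv`, `teleShiftEquiv`. [cite: MochizukiAbsTopIII2015, Corollary 3.6 (ii)/(iii)/(v) pp.79–80] -/
theorem joint_of_iotaOverGalois {H₃ : Δ.sub3.HomotopyFamily} (hH₃ : Δ.IsLogObservableFamily H₃)
    (hν : Δ.toNexus.FullyFaithful) (hι : Δ.IotaOverGaloisStmt)
    (hτ : ∀ x : Δ.X₁, Δ.toNexus.map (τ.η₁.hom.app x) =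
      τ.e.hom.app (Δ.κ.obj (Δ.XtoE.obj (Δ.toNexus.obj x))) ≫ Δ.η.hom.app (Δ.toNexus.obj x)) :
    ∃ H₅ hH₅ hc, ∃ (T : (Δ.sub 4).Telecore (Δ.coreObs5 H₅ hH₅) hc)
      (Hc : (Δ.teleDiagram T.J T.telMap).HomotopyFamily),
      Δ.IsTelecoreAn τ T ∧ Δ.IsContactAn τ T Hc ∧
      (∃ K : (Δ.teleDiagram T.J T.telMap).HomotopyFamily,
        T.Jfam.CompatibleAlong (𝟭q _) K ∧ H₃.CompatibleAlong (embLogTele T.J) K) ∧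
      ∃ (Φ : ℤ → Δ.diagram.SelfEquivalence) (Ψ : ℤ → (Δ.teleDiagram T.J T.telMap).SelfEquivalence),
        Δ.IsShiftAction Φ ∧
        (∀ (m : ℤ) (a : SubVertex {a : LFVertex | a.row ≤ 4}),
          ∃ h : (Φ m).graphMap.obj a.1 ∈ {a : LFVertex | a.row ≤ 4},
            (Ψ m).graphMap.obj ((teleShape T.J).base a) = (teleShape T.J).base ⟨_, h⟩ ∧
            HEq ((Ψ m).hom.app ((teleShape T.J).base a)) ((Φ m).hom.app a.1)) ∧
        (∀ m : ℤ, (Ψ m).graphMap.obj (teleShape T.J).obs = (teleShape T.J).obs ∧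
          HEq ((Ψ m).hom.app (teleShape T.J).obs) (𝟭 Δ.A)) ∧
        (∀ m : ℤ, Nonempty ((Ψ m).hom.CompatibleWith T.Jfam T.Jfam) ∧
          Nonempty ((Ψ m).hom.CompatibleWith Hc Hc)) :=
  ⟨Δ.anCoreFamilyE, univCoreFamily_terminal _ _ _ _ _ _ _,
    univCoreObs_isCore coreShape5 (fun _ => inferInstanceAs (IsEmpty PEmpty)) Δ.coreExt5 Δ.overE4 Δ.AtoE
      Δ.anCIE Δ.fullyFaithfulAtoE reaches5,
    Δ.anTelecoreE τ, Δ.anContact τ hν, Δ.anTelecoreE_isTelecoreAn τ, Δ.anContact_isContactAnE τ hν hτ,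
    Δ.exists_logTeleFamily_of_iotaOverGalois τ hH₃ hν hι,
    Δ.shiftEquiv, Δ.teleShiftEquiv τ, Δ.isShiftAction_shiftEquiv,
    fun m a => Δ.teleShiftEquiv_base τ m a, fun m => Δ.teleShiftEquiv_obs τ m,
    fun m => Δ.shiftTelecoreCompat_overE τ hν m⟩

/-- **The joint witness with `𝔖_log` from Cor. 3.6 (iii), first clause** (`observableLogStmt`, seat
abc-iut-w4-d095): (ii) ∧ (iii)-telecore ∧ (v)-fourth sentence with ONE telecore, for every `Δ` with `id_⋎`
fully faithful, coherent `τ` and `ι` over Galois. [cite: MochizukiAbsTopIII2015, Corollary 3.6 (ii)/(iii)/(v) pp.79–80] -/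
theorem joint_of_iotaOverGaloisStmt (hν : Δ.toNexus.FullyFaithful) (hι : Δ.IotaOverGaloisStmt)
    (hτ : ∀ x : Δ.X₁, Δ.toNexus.map (τ.η₁.hom.app x) =
      τ.e.hom.app (Δ.κ.obj (Δ.XtoE.obj (Δ.toNexus.obj x))) ≫ Δ.η.hom.app (Δ.toNexus.obj x)) :
    ∃ H₅ hH₅ hc, ∃ (T : (Δ.sub 4).Telecore (Δ.coreObs5 H₅ hH₅) hc)
      (Hc : (Δ.teleDiagram T.J T.telMap).HomotopyFamily),
      Δ.IsTelecoreAn τ T ∧ Δ.IsContactAn τ T Hc ∧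
      (∃ K : (Δ.teleDiagram T.J T.telMap).HomotopyFamily,
        T.Jfam.CompatibleAlong (𝟭q _) K ∧
          ∃ H : Δ.sub3.HomotopyFamily, Δ.IsLogObservableFamily H ∧ H.CompatibleAlong (embLogTele T.J) K) ∧
      ∃ (Φ : ℤ → Δ.diagram.SelfEquivalence) (Ψ : ℤ → (Δ.teleDiagram T.J T.telMap).SelfEquivalence),
        Δ.IsShiftAction Φ ∧
        (∀ (m : ℤ) (a : SubVertex {a : LFVertex | a.row ≤ 4}),
          ∃ h : (Φ m).graphMap.obj a.1 ∈ {a : LFVertex | a.row ≤ 4},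
            (Ψ m).graphMap.obj ((teleShape T.J).base a) = (teleShape T.J).base ⟨_, h⟩ ∧
            HEq ((Ψ m).hom.app ((teleShape T.J).base a)) ((Φ m).hom.app a.1)) ∧
        (∀ m : ℤ, (Ψ m).graphMap.obj (teleShape T.J).obs = (teleShape T.J).obs ∧
          HEq ((Ψ m).hom.app (teleShape T.J).obs) (𝟭 Δ.A)) ∧
        (∀ m : ℤ, Nonempty ((Ψ m).hom.CompatibleWith T.Jfam T.Jfam) ∧
          Nonempty ((Ψ m).hom.CompatibleWith Hc Hc)) := by
  obtain ⟨H₃, hH₃⟩ := Δ.observableLogStmt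
  obtain ⟨K, hJ, hH⟩ := Δ.exists_logTeleFamily_of_iotaOverGalois τ hH₃ hν hι
  exact ⟨Δ.anCoreFamilyE, univCoreFamily_terminal _ _ _ _ _ _ _,
    univCoreObs_isCore coreShape5 (fun _ => inferInstanceAs (IsEmpty PEmpty)) Δ.coreExt5 Δ.overE4 Δ.AtoE
      Δ.anCIE Δ.fullyFaithfulAtoE reaches5,
    Δ.anTelecoreE τ, Δ.anContact τ hν, Δ.anTelecoreE_isTelecoreAn τ, Δ.anContact_isContactAnE τ hν hτ,
    ⟨K, hJ, H₃, hH₃, hH⟩,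
    Δ.shiftEquiv, Δ.teleShiftEquiv τ, Δ.isShiftAction_shiftEquiv,
    fun m a => Δ.teleShiftEquiv_base τ m a, fun m => Δ.teleShiftEquiv_obs τ m,
    fun m => Δ.shiftTelecoreCompat_overE τ hν m⟩

/-- **Projections**: the joint witness yields the three typed clauses `TelecoreStmt τ` (ii),
`LogObsCompatTelecoreStmt τ` ((iii), telecore half) and `ShiftTelecoreCompatStmt τ` ((v), fourth
sentence) — now visibly from ONE telecore. [cite: MochizukiAbsTopIII2015, Corollary 3.6 (ii)/(iii)/(v) pp.79–80] -/
theorem telecore_clauses_of_iotaOverGaloisStmt (hν : Δ.toNexus.FullyFaithful) (hι : Δ.IotaOverGaloisStmt)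
    (hτ : ∀ x : Δ.X₁, Δ.toNexus.map (τ.η₁.hom.app x) =
      τ.e.hom.app (Δ.κ.obj (Δ.XtoE.obj (Δ.toNexus.obj x))) ≫ Δ.η.hom.app (Δ.toNexus.obj x)) :
    Δ.TelecoreStmt τ ∧ Δ.LogObsCompatTelecoreStmt τ ∧ Δ.ShiftTelecoreCompatStmt τ := by
  obtain ⟨H₅, hH₅, hc, T, Hc, hT, hHc, ⟨K, hJ, H, hH, hHK⟩, Φ, Ψ, hΦ, hbase, hobs, hcompat⟩ :=
    Δ.joint_of_iotaOverGaloisStmt τ hν hι hτ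
  exact ⟨⟨H₅, hH₅, hc, T, hT, Hc, hHc⟩, ⟨H₅, hH₅, hc, T, hT, K, hJ, H, hH, hHK⟩,
    ⟨H₅, hH₅, hc, T, Hc, hT, hHc, Φ, Ψ, hΦ, hbase, hobs, hcompat⟩⟩

end LogFrobeniusData

end Literature.AnabelianGeometry.AbsoluteAnabelian
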